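import Literature.AlgebraicGeometry.AbelianSchemes.AbelianSchemeOverGlueData
import Literature.AlgebraicGeometry.AbelianSchemes.AbelianSchemeOverZariskiGluingLevel
import HarnessLib

/-!
# Gluing abelian schemes WITH LEVEL STRUCTURE along a cocycle of the base (leaf (Lvl) of hand (h7))

Cell hodgecm-mathlib, F-DAG second hand (h7) «Zariski gluing of `S`-objects from a cocycle», FILE 6; consumer F-8 (8c)
(the universal family with its level structure over the glued moduli scheme `A⁰ = ⋃ V_R`).  INPUT: a cocycle datum of
abelian schemes `𝔊 : CocycleDatum D` over glue data `D` of the base (FILE 5: abelian schemes `Aᵢ` on the slices and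
isomorphisms `θ i j` of abelian schemes over the transitions, with the cocycle condition), level-`N` structures `φᵢ`
on the `Aᵢ` ([MumfordFogartyKirwan1994, Def. 7.1]) and the compatibility «`θ i j` carries `φᵢ|_{V(i,j)}` to
`φⱼ|_{V(j,i)}`» (the pull-back relation of level structures, Def. 7.2, ★ `LevelStructure.IsBaseChangeVia`).  OUTPUT:
`𝔊.levelDatum` (FILE 4's `LevelDatum` for the Zariski gluing datum of FILE 5: overlap level structures = base changes,
★ `LevelStructure.baseChange`; clauses by ★ `LevelStructure.baseChange_isBaseChangeVia` and
`LevelStructure.IsBaseChangeVia.trans`), **`𝔊.levelStructure : 𝔊.abelianScheme.LevelStructure g N`** and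
**`𝔊.isBaseChangeVia_levelStructure i : (φ i).IsBaseChangeVia (𝔊.levelStructure φ hφ) (D.ι i) (𝔊.total.ι i)`** — every slice
level structure IS the restriction of the glued one.  No named fact, no `sorry`, no instance.  HC_CM is proved only
modulo the printed citations until rung 0 closes; this file discharges none of them.

## References
* [MumfordFogartyKirwan1994] D. Mumford, J. Fogarty, F. Kirwan, *Geometric Invariant Theory*, 3rd ed. (1994), Ch. 7
  §2 Def. 7.1 (p. 129) (level structures), Def. 7.2 (p. 129) (pull-back of families).
* [StacksProject] The Stacks Project, Tag 01LH (Relative glueing).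
-/

noncomputable section

universe u

open CategoryTheory CategoryTheory.Limits AlgebraicGeometry MonoidalCategory CartesianMonoidalCategory
open Literature.AlgebraicGeometry.Morphisms

namespace Literature.AlgebraicGeometry.AbelianSchemes

namespace AbelianSchemeOver

/-- Transport of the pull-back relation of level structures along an equality of base maps.
[cite: MumfordFogartyKirwan1994, Ch. 7 §2 Definition 7.2 (p. 129)] -/
theorem LevelStructure.IsBaseChangeVia.congr_base {g₀ n : ℕ} {S S' : Scheme.{u}} {A' : AbelianSchemeOver S'}
    {A : AbelianSchemeOver S} {φ' : A'.LevelStructure g₀ n} {φ : A.LevelStructure g₀ n} {g g' : S' ⟶ S}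
    {G : A'.X.left ⟶ A.X.left} (e : g = g') (h : φ'.IsBaseChangeVia φ g G) : φ'.IsBaseChangeVia φ g' G :=
  e ▸ h

namespace CocycleDatum

variable {D : Scheme.GlueData.{u}} (𝔊 : CocycleDatum D) {g N : ℕ} (φ : ∀ i, (𝔊.A i).LevelStructure g N)
  (hφ : ∀ i j, ((φ i).baseChange (D.f i j)).IsBaseChangeVia ((φ j).baseChange (D.f j i)) (D.t i j) (𝔊.θ i j))

/-- The level structure on the overlap family `A₂ i j` (FILE 5): `φᵢ` base-changed to `V(i,j)` and transported to
`Uᵢ ×_{A⁰} Uⱼ`. [cite: MumfordFogartyKirwan1994, Ch. 7 §2 Definition 7.2 (p. 129)] -/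
def φ₂ (i j : D.J) : (𝔊.A₂ i j).LevelStructure g N :=
  ((φ i).baseChange (D.f i j)).baseChange (isPullback_V D i j).isoPullback.inv

/-- `φ₂ i j` is the pull-back of `φᵢ` along `κ₁`. [cite: MumfordFogartyKirwan1994, Ch. 7 §2 Definition 7.2 (p. 129)] -/
theorem isBaseChangeVia_φ₂_fst (i j : D.J) :
    (𝔊.φ₂ φ i j).IsBaseChangeVia (φ i) (pullback.fst (D.ι i) (D.ι j))
      (pullback.fst _ _ ≫ pullback.fst (𝔊.A i).X.hom (D.f i j)) :=
  LevelStructure.IsBaseChangeVia.congr_base (isPullback_V D i j).isoPullback_inv_fst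
    ((((φ i).baseChange (D.f i j)).baseChange_isBaseChangeVia (isPullback_V D i j).isoPullback.inv).trans
      ((φ i).baseChange_isBaseChangeVia (D.f i j)))

include hφ in
/-- `φ₂ i j` is the pull-back of `φⱼ` along `κ₂` (uses the compatibility `hφ` of `θ` with the level structures).
[cite: MumfordFogartyKirwan1994, Ch. 7 §2 Definition 7.2 (p. 129)] -/
theorem isBaseChangeVia_φ₂_snd (i j : D.J) :
    (𝔊.φ₂ φ i j).IsBaseChangeVia (φ j) (pullback.snd (D.ι i) (D.ι j))
      ((pullback.fst _ _ ≫ 𝔊.θ i j) ≫ pullback.fst (𝔊.A j).X.hom (D.f j i)) := by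
  have e : ((isPullback_V D i j).isoPullback.inv ≫ D.t i j) ≫ D.f j i = pullback.snd (D.ι i) (D.ι j) := by
    rw [Category.assoc]
    exact (isPullback_V D i j).isoPullback_inv_snd
  exact LevelStructure.IsBaseChangeVia.congr_base e
    (((((φ i).baseChange (D.f i j)).baseChange_isBaseChangeVia (isPullback_V D i j).isoPullback.inv).trans
      (hφ i j)).trans ((φ j).baseChange_isBaseChangeVia (D.f j i)))

/-- The FILE 4 `LevelDatum` on the Zariski gluing datum of FILE 5, read off the slice level structures.
[cite: MumfordFogartyKirwan1994, Ch. 7 §2 Definition 7.1 (p. 129)] -/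
def levelDatum : 𝔊.zariskiGluingDatum.LevelDatum g N where
  φ := φ
  φ₂ := 𝔊.φ₂ φ
  hφ₁ := 𝔊.isBaseChangeVia_φ₂_fst φ
  hφ₂ := 𝔊.isBaseChangeVia_φ₂_snd φ hφ

/-- **The glued level-`N` structure on the glued abelian scheme over `A⁰ = D.glued`** (FILE 4 `levelStructure`).
[cite: MumfordFogartyKirwan1994, Ch. 7 §2 Definition 7.1 (p. 129)] -/
def levelStructure : 𝔊.abelianScheme.LevelStructure g N :=
  𝔊.zariskiGluingDatum.levelStructure (𝔊.levelDatum φ hφ)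

/-- **Every slice level structure `φᵢ` is the restriction of the glued one**, along `Uᵢ ↪ A⁰` via the chart `Aᵢ ↪ ⋃ Aᵢ`.
[cite: MumfordFogartyKirwan1994, Ch. 7 §2 Definition 7.2 (p. 129)] [cite: StacksProject, Tag 01LH] -/
theorem isBaseChangeVia_levelStructure (i : D.J) :
    (φ i).IsBaseChangeVia (𝔊.levelStructure φ hφ) (D.ι i) (𝔊.total.ι i) :=
  𝔊.zariskiGluingDatum.isBaseChangeVia_levelStructure (𝔊.levelDatum φ hφ) i

end CocycleDatum

end AbelianSchemeOver

end Literature.AlgebraicGeometry.AbelianSchemes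

end
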